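import Mathlib
import HarnessLib
import Summits.NavierStokesRegularity.NavierStokesRegularity.Theorems.TaylorModelRungThreeCertificateFormat
import Summits.NavierStokesRegularity.NavierStokesRegularity.Theorems.TaylorModelRungThreeCertificateSoundChain
import Summits.NavierStokesRegularity.NavierStokesRegularity.Theorems.TaylorModelRungThreeCertificateSoundEntry
import Summits.NavierStokesRegularity.NavierStokesRegularity.Theorems.TaylorModelRungThreeCertificateScalar
import Summits.NavierStokesRegularity.NavierStokesRegularity.Theorems.TaylorModelRungThreeCertificateData1

/-!
# Crux K1b-DR (stmt-NavierStokesRegularity-23954), line `taylor-model` — COMPACT INPUT FORMAT for the certificate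
# tables (jets computed Lean-side, frames shared per stage) expanding into the format of record

The format of record (`CertTables`, p602753) carries, per node, the Taylor jets `P n` and the variational jets `W n`
(`(p+1)·n + (p+1)·n²` scalars) and a frame pair (`2n²`); at realistic sizes these dominate the source by orders of
magnitude (K-SIZE-23954). Since the jets are DETERMINED by the centre `x` and the structure table through the exact
recursions a18/a20 of `Chain`, and frames may be shared by consecutive nodes, this file defines a COMPACT input
record `CertTablesC` (per node: scalars, centre, radii and a frame INDEX into a per-stage frame list; no jets) and the
Lean-side decompressor `CertTablesC.expand : CertTablesC K → CertTables K`, which computes the jets by the recursions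
(`jetsP`, `jetsW`) and looks the frames up. NOTHING about soundness changes: the checkers and `chain_of_checks` run on
`C.expand`, an ordinary `CertTables`. Demonstration: `toy3` (the compact form of toy #2): the expansion reproduces the
jets, and `checkCoef` / `checkPolyTails` / `checkEntry` / `checkNode 0 0` pass in the kernel; whole-chain replay of
expanded tables is meant for `native_decide` (the kernel re-evaluates the unshared expansion at every access).
MODEL-lattice rung TL-M3; nothing here is a statement about the Navier–Stokes equations.
-/

-- the sub-problem namespace repeats the summit name by design (D-0017)
set_option linter.dupNamespace false

namespace Summit.NavierStokesRegularity.NavierStokesRegularity.Theorems.TaylorModelCert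

open Literature.Analysis.FluidPDE.TaoCascade Literature.Analysis.FluidPDE.TaoCascade.TaylorChain

/-- Compact per-node record: scalars, centre, parallelepiped radii, and the INDEX of the node's frame pair in the
stage's frame list (no jet tables). [folklore] -/
structure NodeTablesC (K : Type) where
  (Tn mC EI E EO ρ ρO NCi : K)
  x : List K
  rP : List K
  fr : ℕ

/-- Compact per-stage record: as `StageTables` but with a shared frame list `frames = [(Cm, Ci), …]` and compact
nodes. [folklore] -/
structure StageTablesC (K : Type) where
  S : ℕ
  ω : List K
  (bb κ Λ δ Lv as γ Nσ lev dm ΛX : K)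
  nx : ℕ
  ell : List (List K)
  (ctr rad s β NDL : List K)
  σf : List K
  frames : List (List (List K) × List (List K))
  nodes : List (NodeTablesC K)
  steps : List (StepTables K)

/-- Compact certificate record (global block as in `CertTables`). [folklore] -/
structure CertTablesC (K : Type) where
  (Kb Ka : ℤ)
  (pdeg N₀ : ℕ)
  (R θ c η₀ Cb Cg τs mm : K)
  i₀ : Fin 4
  X₀ : List K
  (M W : List K)
  α : List K
  coef : List K
  stages : List (StageTablesC K)

namespace CertTablesC

variable {K : Type} [Field K] [LinearOrder K]

/-- The global block as a `CertTables` with no stages (carries `n`, `coefAt`, `QbVec`, `symQbMat`). [folklore] -/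
def skeleton (C : CertTablesC K) : CertTables K where
  Kb := C.Kb
  Ka := C.Ka
  pdeg := C.pdeg
  N₀ := C.N₀
  R := C.R
  θ := C.θ
  c := C.c
  η₀ := C.η₀
  Cb := C.Cb
  Cg := C.Cg
  τs := C.τs
  mm := C.mm
  i₀ := C.i₀
  X₀ := C.X₀
  M := C.M
  W := C.W
  α := C.α
  coef := C.coef
  stages := []

/-- The Taylor jets `[P 0, …, P pdeg]` of the truncated field at the centre `x`, by the exact recursion
`(q+1)·P (q+1) = Σ_{m' ≤ q} Qb (P m') (P (q-m'))` (clause a18). [folklore] -/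
def jetsP (G : CertTables K) (pdeg : ℕ) (x : List K) : List (List K) :=
  (List.range pdeg).foldl (fun acc q =>
    acc ++ [(List.range G.n).map fun c => (1 / (((q : ℕ) : K) + 1)) *
      vget ((List.range (q + 1)).foldr (fun m' s => addVecN G.n (G.QbVec (acc.getD m' []) (acc.getD (q - m') [])) s)
        ((List.range G.n).map fun _ => (0 : K))) c]) [x]

/-- The variational jets `[W 0, …, W pdeg]`, by `(q+1)·W (q+1) = Σ_{m' ≤ q} symQbMat (P m') · W (q-m')` (clause a20),
`W 0 = I`. [folklore] -/
def jetsW (G : CertTables K) (pdeg : ℕ) (P : List (List K)) : List (List (List K)) :=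
  (List.range pdeg).foldl (fun acc q =>
    acc ++ [smulMatN G.n (1 / (((q : ℕ) : K) + 1))
      ((List.range (q + 1)).foldr (fun m' s => addMatN G.n (mulMatN G.n (G.symQbMat (P.getD m' [])) (acc.getD (q - m') []))
        s) ((List.range G.n).map fun _ => (List.range G.n).map fun _ => (0 : K)))]) [G.idMat]

/-- Expansion of a compact node: jets computed, frames looked up. [folklore] -/
def expandNode (G : CertTables K) (pdeg : ℕ) (frames : List (List (List K) × List (List K))) (N : NodeTablesC K) :
    NodeTables K :=
  { Tn := N.Tn, mC := N.mC, EI := N.EI, E := N.E, EO := N.EO, ρ := N.ρ, ρO := N.ρO, NCi := N.NCi, x := N.x,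
    P := jetsP G pdeg N.x, rP := N.rP, Cm := (frames.getD N.fr ([], [])).1, Ci := (frames.getD N.fr ([], [])).2,
    W := jetsW G pdeg (jetsP G pdeg N.x) }

/-- Expansion of a compact stage. [folklore] -/
def expandStage (G : CertTables K) (pdeg : ℕ) (St : StageTablesC K) : StageTables K :=
  { S := St.S, ω := St.ω, bb := St.bb, κ := St.κ, Λ := St.Λ, δ := St.δ, Lv := St.Lv, as := St.as, γ := St.γ, Nσ := St.Nσ,
    lev := St.lev, dm := St.dm, ΛX := St.ΛX, nx := St.nx, ell := St.ell, ctr := St.ctr, rad := St.rad, s := St.s, β := St.β,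
    NDL := St.NDL, σf := St.σf, nodes := St.nodes.map (expandNode G pdeg St.frames), steps := St.steps }

/-- **The decompressor** into the format of record. [folklore] -/
def expand (C : CertTablesC K) : CertTables K :=
  { C.skeleton with stages := C.stages.map (expandStage C.skeleton C.pdeg) }

end CertTablesC

/-! ### Demonstration: the compact form of toy #2 -/

/-- Compact nodes of toy #2 (frame index 0). [folklore] -/
def toy3Node0 : NodeTablesC QS2 where
  Tn := 0
  mC := 0
  EI := 0
  E := 0
  EO := 0
  ρ := 1
  ρO := 1
  NCi := 1
  x := [0, 0, 0, 0, 0, 0, 0, 0]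
  rP := [1, 1, 1, 1, 1, 1, 1, 1]
  fr := 0

/-- Second compact node of toy #2. [folklore] -/
def toy3Node1 : NodeTablesC QS2 := { toy3Node0 with Tn := 1, EO := 1, ρ := 1, ρO := 2 }

/-- Compact stage of toy #2: ONE shared frame pair (identity, identity). [folklore] -/
def toy3Stage : StageTablesC QS2 where
  S := 1
  ω := [1, 1]
  bb := 0
  κ := 1
  Λ := 0
  δ := 0
  Lv := 1
  as := 1
  γ := 1
  Nσ := 1
  lev := 0
  dm := 1
  ΛX := 1
  nx := 0
  ell := toy2Id
  ctr := [0, 0, 0, 0, 0, 0, 0, 0]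
  rad := [1, 1, 1, 1, 1, 1, 1, 1]
  s := [0, 0, 0, 0, 0, 0, 0, 0]
  β := [0, 0, 0, 0, 0, 0, 0, 0]
  NDL := [0, 0, 0, 0, 0, 0, 0, 0]
  σf := [0, 0, 0, 0, 0, 0, 0, 0]
  frames := [(toy2Id, toy2Id)]
  nodes := [toy3Node0, toy3Node1]
  steps := [toy2Step]

/-- The compact form of toy #2. [folklore] -/
def toy3 : CertTablesC QS2 where
  Kb := 0
  Ka := 1
  pdeg := 1
  N₀ := 0
  R := 64
  θ := 0
  c := 1
  η₀ := 1
  Cb := 1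
  Cg := 1
  τs := 1
  mm := 1
  i₀ := 0
  X₀ := [1, 0, 0, 0]
  M := [10, 10, 10, 10]
  W := [0, 0, 0, 0]
  α := []
  coef := []
  stages := [toy3Stage]

/-- The decompressor computes the (here trivial) jets of toy #2. [folklore] -/
example : (toy3.expand.node 0 0).P = [[0, 0, 0, 0, 0, 0, 0, 0], [0, 0, 0, 0, 0, 0, 0, 0]] := by decide +kernel

/-- The kernel accepts the expanded compact toy: coefficient table. [folklore] -/
theorem toy3_checkCoef : toy3.expand.checkCoef = true := by decide +kernel

/-- The kernel accepts the expanded compact toy: tail test. [folklore] -/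
theorem toy3_checkPolyTails : toy3.expand.checkPolyTails = true := by decide +kernel

/-- The kernel accepts the expanded compact toy: entry certificate. [folklore] -/
theorem toy3_checkEntry : toy3.expand.checkEntry toy2Entry = true := by decide +kernel

/-- The kernel accepts node `(0,0)` of the expanded compact toy (jets computed, then re-verified by `checkNode`).
NOTE: under kernel `decide` the expansion is re-evaluated at every table access (the kernel does not share the
`let`-bound node), so whole-chain replay of EXPANDED tables is for `native_decide` (compiled, evaluated once; dss_28);
the literal format of record remains kernel-`decide`-able as in `…CertificateData1`. [folklore] -/
example : toy3.expand.checkNode 0 0 = true := by decide +kernel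

end Summit.NavierStokesRegularity.NavierStokesRegularity.Theorems.TaylorModelCert
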